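import Summits.QuantumFields.Balaban3D.Proofs.RestrictedResidualsStd
import Summits.QuantumFields.Balaban3D.Proofs.FamilyLE

/-!
# Bałaban CMP 102 (1985), d = 3 lane — `Proofs.RestrictedResidualsAlpha` (3/3): **THE RESTRICTED READINGS OF (41)/(47) FOR THE END
# THEOREM'S CONSTRUCTION FROM ITS OWN (α) INPUTS** — `RunAlpha ⇒ Ineq41RestrictedAE ∧ Ineq47RestrictedAE` at `ε₁ = g_kp(g_k)` for
# `towerW 𝔠.lane X 𝔖 = laneT 𝔠 X 𝔖 G 𝔊 S`, every `k ≤ K`, on the exhibited family; the χ-of-(4) lower bound and the K1-S sandwich likewise;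
# and the same in the quantifier shape of `UVStability3DInputs.uvStability3D_of_inputs` (cell `ym3-torus` node N6a IN-TREE-MODULO-(α))

Source: T. Bałaban, *Ultraviolet stability of three-dimensional lattice pure gauge field theories*, Commun. Math. Phys. **102** (1985)
255–275 [Balaban1985UV3] ([B10]; PDF page = journal page − 254).  (41) p. 266, (47) p. 267 L17–20, and p. 272 L32–33 «The lower bound is
proved in the same way, with all simplifications coming from the fact that Ω_{k+1} = T_η.»  Cell `ym3-torus` (HUMAN RULING D-0037, YM
ladder rung R3), seat p1 gen 3, task P1-7 of the cell's TARGET.md §4: «a typed reduction `RunAlpha … → Ineq41Restricted W δ k` turns node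
N6a's GAP-STATED into IN-TREE-MODULO-(α)».

WHAT THIS FILE PROVES: `restricted41_47_of_alpha`, `restricted47_chi_of_alpha`, `sandwich_ae_of_alpha` (from `RunAlpha` on the family, via
`RestrictedResiduals.trivStepInputs_of_alpha` and `RestrictedResidualsStd`), `restricted41_47_of_inputs` (END-theorem quantifier shape), and the
same for the PINNED tower objects (`rhoRes_pin`, `ineq41RestrictedAE_pin_iff`, `ineq47RestrictedAE_pin_iff`, `restricted41_47_of_inputs_pin`);
profile monotonicity `rhoRes_mono_ae` / `ineq41RestrictedAE_of_le` (generic) and `ineq41RestrictedAE_of_alpha_of_le`: the UPPER reading from (α)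
at every profile `δ ≤ ε₁` (the LOWER one only at `ε₁` — a (57)-type residual at a smaller threshold is not among the lane's rows); and ALL OF IT ON
THE `≤`-FAMILY `S.g²·S.ε₀ ≤ (min γ₀ 1)²` of `FamilyLE` (cell interface I-3: terminal coupling AT MOST the leaf threshold instead of equal to it):
`trivStepInputs_of_alpha_le`, `restricted41_47_of_alpha_le`, `restricted47_chi_of_alpha_le`, `sandwich_ae_of_alpha_le`,
`ineq41RestrictedAE_of_alpha_le_of_le`, `restricted41_47_of_inputs_le` (quantifier shape of `FamilyLE.uvStability3D_of_inputs_le`).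
WHAT IT MEANS FOR THE CELL'S DAG (TARGET.md v2 §2): node N6a's hypotheses `Ineq41Restricted`/`Ineq47Restricted` (in the a.e. forms the
lane's a.e.-defined `T` can inhabit) are THEOREMS MODULO THE (α) ROWS of node N4in — the SAME trust base as UV3 (node N4) minus the
large-field rows — and the edge N5thr → N6a disappears (no threshold inclusion is consumed).
HONEST FRAMING (lane PLAN.md §0): UV stability of the d = 3 lattice theory on a finite torus, as printed, MODULO its printed inputs — NOT a
continuum limit, NOT a mass gap, NOT d = 4, nothing about the Millennium problem; the residuals, leaves and (α) rows are hypotheses; nothing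
of the paper is asserted.  No `sorry`, no new axiom.
-/

noncomputable section

namespace Summit.QuantumFields.Balaban3D.Proofs.RestrictedResidualsAlpha

open _root_.MeasureTheory
open Literature.MathematicalPhysics.QuantumFieldTheory.Balaban1983to89
open Literature.MathematicalPhysics.QuantumFieldTheory.Balaban1983to89.AveragingRT (rnTransport rnTransport_nonneg)
open Literature.MathematicalPhysics.QuantumFieldTheory.Balaban1983to89.B10SectAGathering
open Literature.MathematicalPhysics.QuantumFieldTheory.Balaban1985CMP102
open Literature.MathematicalPhysics.QuantumFieldTheory.Balaban1985CMP102.Setting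
open Literature.MathematicalPhysics.QuantumFieldTheory.Balaban1985CMP102.SectB.TowerObjects (chiAll rt_mono_ae)
open Summit.QuantumFields.Balaban3D.Carriers
open Summit.QuantumFields.Balaban3D.Proofs.Bound55Masses
open Summit.QuantumFields.Balaban3D.Proofs.Bound55Std

open Summit.QuantumFields.Balaban3D.Proofs.RestrictedResiduals
open Summit.QuantumFields.Balaban3D.Proofs.RestrictedResidualsStd
open Summit.QuantumFields.Balaban3D.Proofs.Inputs
open Summit.QuantumFields.Balaban3D.Proofs.Primitives
open Summit.QuantumFields.Balaban3D.Proofs.Constants (eps0Of)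
open Summit.QuantumFields.Balaban3D.Proofs.UVStability3DInputs
open Summit.QuantumFields.Balaban3D.Proofs.GroupModelLieC (lieC)
open Summit.QuantumFields.Balaban3D.Proofs.FamilyLE (stepResiduals_of_alpha_le)
variable {L : ℕ}

/-! ## Profile monotonicity: the UPPER reading transfers to every smaller threshold profile `δ ≤ ε₁` (the lower one does not — it would be a
(57)-type residual at threshold `δ`, which the lane does not book) -/

section Mono

variable {S : Scales L} {G : Type} [GaugeGroup G] [MeasurableSpace G] [HaarData G] (W : SectB.TowerObjects S G)

omit [MeasurableSpace G] [HaarData G] in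
/-- `χ^δ ≤ χ^{δ'}` pointwise for `δ ≤ δ'` (a `δ`-small field is `δ'`-small). [cite: Balaban1985UV3, (40) p.266] -/
theorem chiAll_mono (j : ℕ) {δ δ' : ℝ} (h : δ ≤ δ') (V : GaugeField S.P j G) :
    chiAll (S := S) (G := G) j δ V ≤ chiAll (S := S) (G := G) j δ' V := by
  by_cases hV : PlaqSmall δ V
  · have hV' : PlaqSmall δ' V := fun p => lt_of_lt_of_le (hV p) h
    rw [(SectB.TowerObjects.chiAll_eq_one_iff j δ V).2 hV, (SectB.TowerObjects.chiAll_eq_one_iff j δ' V).2 hV']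
  · rw [(SectB.TowerObjects.chiAll_eq_zero_iff j δ V).2 hV]
    exact SectB.TowerObjects.chiAll_nonneg j δ' V

/-- **THE RESTRICTED DENSITIES ARE MONOTONE IN THE THRESHOLD PROFILE, dV-a.e.**: `δ ≤ δ'` ⇒ `ρ^res[δ]_k ≤ ρ^res[δ']_k` a.e. (smaller small-field
factors on every level; `T` positive and monotone a.e. — the spine's `rt_mono_ae`), under the integrability package (discharged for the lane's tower
by `RestrictedResiduals.integrable_rhoRes_std` / `integrable_T_rhoRes_std`). [cite: Balaban1985UV3, (2) p.256 + (40) p.266] -/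
theorem rhoRes_mono_ae {δ δ' : ℕ → ℝ} (hle : ∀ j, δ j ≤ δ' j) (hav : ∀ j, Measurable (W.av j).avg)
    (hint : ∀ j, Integrable (W.rhoRes δ j) (fieldMeasure S.P j G)) (hint' : ∀ j, Integrable (W.rhoRes δ' j) (fieldMeasure S.P j G))
    (hT : ∀ j, Integrable ((W.T j).T (W.rhoRes δ j)) (fieldMeasure S.P (j + 1) G))
    (hT' : ∀ j, Integrable ((W.T j).T (W.rhoRes δ' j)) (fieldMeasure S.P (j + 1) G)) :
    ∀ k, W.rhoRes δ k ≤ᵐ[fieldMeasure S.P k G] W.rhoRes δ' k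
  | 0 => ae_of_all _ fun U => by
      rw [SectB.TowerObjects.rhoRes_zero, SectB.TowerObjects.rhoRes_zero]
      exact mul_le_mul_of_nonneg_right (chiAll_mono 0 (hle 0) U) (by unfold RunObjects.rho0; exact (Real.exp_pos _).le)
  | k + 1 => by
      have ih := rhoRes_mono_ae hle hav hint hint' hT hT' k
      have hmono := rt_mono_ae (W.T k) (hav k) (hint k) (hint' k) (hT k) (hT' k) ih
      filter_upwards [hmono] with V hV
      rw [SectB.TowerObjects.rhoRes_succ, SectB.TowerObjects.rhoRes_succ]
      exact mul_le_mul (chiAll_mono (k + 1) (hle (k + 1)) V) hV ((W.T k).pos _ (W.rhoRes_nonneg δ k) V)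
        (SectB.TowerObjects.chiAll_nonneg (k + 1) _ V)

/-- **THE UPPER READING TRANSFERS ALONG `ρ^res[δ]_k ≤ ρ^res[δ']_k` a.e.** (e.g. down the profile `δ ≤ δ'`, `rhoRes_mono_ae`):
`Ineq41RestrictedAE W δ' k` gives `Ineq41RestrictedAE W δ k` (off the `δ_k`-small set `ρ^res[δ]_k = 0`; on it `χ^{δ_k} = 1 ≥ χ^{δ'_k}`).
The LOWER reading does NOT transfer to smaller profiles. [cite: Balaban1985UV3, (41) p.266] -/
theorem ineq41RestrictedAE_of_le {δ δ' : ℕ → ℝ} (k : ℕ)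
    (hmono : W.rhoRes δ k ≤ᵐ[fieldMeasure S.P k G] W.rhoRes δ' k) (h41 : W.Ineq41RestrictedAE δ' k) :
    W.Ineq41RestrictedAE δ k := by
  filter_upwards [hmono, h41] with V h1 h2
  by_cases hV : PlaqSmall (δ k) V
  · rw [(SectB.TowerObjects.chiAll_eq_one_iff k (δ k) V).2 hV, one_mul]
    refine h1.trans (h2.trans ?_)
    exact mul_le_of_le_one_left (Real.exp_pos _).le (SectB.TowerObjects.chiAll_le_one k (δ' k) V)
  · rw [W.rhoRes_eq_zero_of_not_small δ k V hV, (SectB.TowerObjects.chiAll_eq_zero_iff k (δ k) V).2 hV, zero_mul]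

end Mono

section Alpha

variable {S : Scales L} {G : Type} [GaugeGroup G] [MeasurableSpace G] [HaarData G] {𝔊 : GroupModel G} {𝔠 : AlphaConsts L 𝔊.N}
  {X : ExternalInputs S G} {𝔖 : ∀ k, StepSeries S G ↥(lieC 𝔊) (nblkOf S 𝔠.lane.carrier k) k} {𝔄 : AlphaData 𝔊 𝔠 X 𝔖}
  (hS : S.ε₀ = eps0Of 𝔠.gamma0 S.g)
include hS

/-- **N6a IN-TREE-MODULO-(α) — THE RESTRICTED READINGS OF (41)/(47) FOR THE END THEOREM'S CONSTRUCTION FROM ITS OWN (α) INPUTS**: on the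
exhibited family `S.ε₀ = ε₀(S.g)`, the (α) inputs `RunAlpha` of the lane's END theorem `uvStability3D_of_inputs` give, for every `k ≤ K`, the
spine's `Ineq41RestrictedAE` and `Ineq47RestrictedAE` for the constructed tower `towerW 𝔠.lane X 𝔖` (= `laneT 𝔠 X 𝔖 G 𝔊 S`) at the threshold
profile `ε₁(k) = g_kp(g_k)` — the same hypothesis list as Theorem 2's (41)/(47) for the FULL densities, minus the large-field rows, and
WITHOUT the threshold inclusion G3D-09 / N5thr. [cite: Balaban1985UV3, (41) p.266 + (47) p.267 + Thm 2 p.272] -/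
theorem restricted41_47_of_alpha (R : RunAlpha 𝔊 𝔠 X 𝔖 𝔄) (k : ℕ) (hk : k ≤ S.K) :
    (towerW 𝔠.lane X 𝔖).Ineq41RestrictedAE (eps1Of S 𝔠.lane.carrier) k ∧
      (towerW 𝔠.lane X 𝔖).Ineq47RestrictedAE (eps1Of S 𝔠.lane.carrier) k := by
  haveI : RegularGaugeGroup G := groupModel_regularGaugeGroup 𝔊
  have D : ∀ j, j + 1 ≤ S.K → TrivStepInputs X 𝔠.lane.carrier 𝔖 (fun _ => True) j :=
    fun j hj => trivStepInputs_of_alpha hS j hj (R.steps j hj)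
  exact ⟨ineq41RestrictedAE_std X 𝔠.lane.carrier 𝔖 (fun _ => True) D k hk,
    ineq47RestrictedAE_std X 𝔠.lane.carrier 𝔖 (fun _ => True) D k hk⟩

/-- **THE χ-OF-(4) LOWER BOUND FROM (α)** (stronger than `Ineq47RestrictedAE`: no `χ^{47}_k` factor): `χ_k·exp[F − E_k − Rm_k] ≤ ρ^res_k` dV-a.e.
for the constructed tower, `k ≤ K`. [cite: Balaban1985UV3, (47) p.267 + p.272 L32–33] -/
theorem restricted47_chi_of_alpha (R : RunAlpha 𝔊 𝔠 X 𝔖 𝔄) (k : ℕ) (hk : k ≤ S.K) :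
    ∀ᵐ V ∂(fieldMeasure S.P k G), (towerW 𝔠.lane X 𝔖).chi k V *
        Real.exp ((towerW 𝔠.lane X 𝔖).explicitExpo k V - (towerW 𝔠.lane X 𝔖).Ecst k - (towerW 𝔠.lane X 𝔖).Rm k)
      ≤ (towerW 𝔠.lane X 𝔖).rhoRes (eps1Of S 𝔠.lane.carrier) k V := by
  haveI : RegularGaugeGroup G := groupModel_regularGaugeGroup 𝔊
  exact restricted47_chi_ae X 𝔠.lane.carrier 𝔖 (fun _ => True)
    (fun j hj => trivStepInputs_of_alpha hS j hj (R.steps j hj)) k hk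

/-- **THE K1-S SANDWICH FROM (α), NO THRESHOLD INCLUSION**: for dV-a.e. `V` with all plaquette variables `g_kp(g_k)`-small,
`e^{−E_k − Rm_k}·e^{F(V)} ≤ ρ^res_k(V) ≤ e^{−E_k + Rm_k}·e^{F(V)}` for the constructed tower, `k ≤ K` — the cell's node N6a («on the good event the
restricted density at height `k` is the explicit Gibbs factor up to `e^{±Rm_k}`», log-radius sized by `SectBRemainder.Rm_le_height`) modulo
EXACTLY the (α) rows of the END theorem. [cite: Balaban1985UV3, (41) p.266 + (47) p.267] -/
theorem sandwich_ae_of_alpha (R : RunAlpha 𝔊 𝔠 X 𝔖 𝔄) (k : ℕ) (hk : k ≤ S.K) :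
    ∀ᵐ V ∂(fieldMeasure S.P k G), PlaqSmall (eps1Of S 𝔠.lane.carrier k) V →
      Real.exp (-(towerW 𝔠.lane X 𝔖).Ecst k - (towerW 𝔠.lane X 𝔖).Rm k) * Real.exp ((towerW 𝔠.lane X 𝔖).explicitExpo k V)
        ≤ (towerW 𝔠.lane X 𝔖).rhoRes (eps1Of S 𝔠.lane.carrier) k V ∧
      (towerW 𝔠.lane X 𝔖).rhoRes (eps1Of S 𝔠.lane.carrier) k V
        ≤ Real.exp (-(towerW 𝔠.lane X 𝔖).Ecst k + (towerW 𝔠.lane X 𝔖).Rm k) * Real.exp ((towerW 𝔠.lane X 𝔖).explicitExpo k V) := by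
  haveI : RegularGaugeGroup G := groupModel_regularGaugeGroup 𝔊
  exact sandwich_ae_std X 𝔠.lane.carrier 𝔖 (fun _ => True)
    (fun j hj => trivStepInputs_of_alpha hS j hj (R.steps j hj)) k hk

/-- **THE UPPER READING FROM (α) AT ANY PROFILE `δ ≤ ε₁`** (e.g. the matched profile `deltaMatched` of `SectBThreshold`, below `g_kp(g_k)` by the
factor `B₃`): `RunAlpha` ⇒ `Ineq41RestrictedAE (towerW 𝔠.lane X 𝔖) δ k`, `k ≤ K` — profile monotonicity (`rhoRes_mono_ae`, integrability
discharged) + the reading at `ε₁`.  (The lower reading is available at `ε₁` only: `restricted41_47_of_alpha`.) [cite: Balaban1985UV3, (41) p.266] -/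
theorem ineq41RestrictedAE_of_alpha_of_le (R : RunAlpha 𝔊 𝔠 X 𝔖 𝔄) (δ : ℕ → ℝ) (hδ : ∀ j, δ j ≤ eps1Of S 𝔠.lane.carrier j)
    (k : ℕ) (hk : k ≤ S.K) : (towerW 𝔠.lane X 𝔖).Ineq41RestrictedAE δ k := by
  haveI : RegularGaugeGroup G := groupModel_regularGaugeGroup 𝔊
  refine ineq41RestrictedAE_of_le (towerW 𝔠.lane X 𝔖) k ?_ (restricted41_47_of_alpha hS R k hk).1
  exact rhoRes_mono_ae (towerW 𝔠.lane X 𝔖) hδ X.av_meas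
    (integrable_rhoRes_std X 𝔠.lane.carrier 𝔖 (fun _ => True) δ)
    (integrable_rhoRes_std X 𝔠.lane.carrier 𝔖 (fun _ => True) (eps1Of S 𝔠.lane.carrier))
    (integrable_T_rhoRes_std X 𝔠.lane.carrier 𝔖 (fun _ => True) δ)
    (integrable_T_rhoRes_std X 𝔠.lane.carrier 𝔖 (fun _ => True) (eps1Of S 𝔠.lane.carrier)) k

end Alpha

/-! ## The same ON THE `≤`-FAMILY `S.g²·S.ε₀ ≤ (min γ₀ 1)²` (`FamilyLE`; cell interface I-3) -/

section AlphaLE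

variable {S : Scales L} {G : Type} [GaugeGroup G] [MeasurableSpace G] [HaarData G] {𝔊 : GroupModel G} {𝔠 : AlphaConsts L 𝔊.N}
  {X : ExternalInputs S G} {𝔖 : ∀ k, StepSeries S G ↥(lieC 𝔊) (nblkOf S 𝔠.lane.carrier k) k} {𝔄 : AlphaData 𝔊 𝔠 X 𝔖}
  (hle : S.g ^ 2 * S.ε₀ ≤ (min 𝔠.gamma0 1) ^ 2)
include hle

/-- **THE TRIVIAL-HISTORY INPUTS OF STEP `k` FROM THE (α) INPUTS OF STEP `k`, ON THE `≤`-FAMILY** — `RestrictedResiduals.trivStepInputs_of_alpha`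
verbatim with the leaves C3–C8, C10 taken from `FamilyLE.stepResiduals_of_alpha_le` (the family equation enters only through `g_k ≤ γ₀`).
[cite: Balaban1985UV3, (55)–(62) pp.269–272 + (47) p.267] -/
def trivStepInputs_of_alpha_le (k : ℕ) (hk : k + 1 ≤ S.K) (A : StepAlpha 𝔊 𝔠 X 𝔖 𝔄 k) :
    TrivStepInputs X 𝔠.lane.carrier 𝔖 (fun _ => True) k where
  P := piecesW 𝔠.lane X 𝔖 k
  Cz := 𝔠.lane.sc.Cz
  C₁ := 𝔠.lane.sc.C₁
  C₁' := 𝔠.lane.sc.C₁'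
  C₂ := 𝔠.lane.sc.C₂
  Cv := 𝔠.lane.sc.Cv
  C₃ := 𝔠.lane.sc.C₃
  C₄ := 𝔠.lane.sc.C₄
  C₅ := 𝔠.lane.sc.C₅
  c₁ := 3
  C₆ := 𝔠.lane.sc.C₆
  fibre49_triv := A.fibre49 (Hist.triv S.P (k + 1))
  fibre57Low := A.fibre57Low
  cumulant58 := cumulant58_piecesW (stepResiduals_of_alpha_le hle k hk A).cumulant58
  cumulantLower := cumulantLower_piecesW (stepResiduals_of_alpha_le hle k hk A).cumulantLower
  repr33_60 := repr33_60_piecesW (stepResiduals_of_alpha_le hle k hk A).repr33_60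
  vacuumWhole := vacuumWhole_piecesW (stepResiduals_of_alpha_le hle k hk A).vacuumWhole
  decomp35_61 := decomp35_61_piecesW (stepResiduals_of_alpha_le hle k hk A).decomp35_61
  norm35 := norm35_piecesW (stepResiduals_of_alpha_le hle k hk A).norm35
  starCount := starCount_piecesW (starCount_pieces 𝔠.lane X 𝔖 k hk)
  oldOutside := oldOutside_piecesW (stepResiduals_of_alpha_le hle k hk A).oldOutside
  pintSucc := pintSucc_piecesW 𝔠.lane X 𝔖 k
  estep62 := estep62_piecesW 𝔠.lane X 𝔖 k
  rmSucc := rmSucc_piecesW (rmSucc_pieces 𝔠.lane X 𝔖 k)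
  hU := A.hU (Hist.triv S.P k)
  hPm := A.hPm (Hist.triv S.P k)
  cP := 𝔄.cP k
  hPb := fun U => A.hPb (Hist.triv S.P k) U

/-- **N6a IN-TREE-MODULO-(α) ON THE `≤`-FAMILY**: `RunAlpha` ⇒ the spine's `Ineq41RestrictedAE` and `Ineq47RestrictedAE` for the constructed
tower `towerW 𝔠.lane X 𝔖` at `ε₁(k) = g_kp(g_k)`, every `k ≤ K`, for EVERY lattice approximation with `g²ε₀ ≤ (min γ₀ 1)²`
(`RestrictedResidualsAlpha.restricted41_47_of_alpha` with `hS` weakened). [cite: Balaban1985UV3, (41) p.266 + (47) p.267 + Thm 2 p.272] -/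
theorem restricted41_47_of_alpha_le (R : RunAlpha 𝔊 𝔠 X 𝔖 𝔄) (k : ℕ) (hk : k ≤ S.K) :
    (towerW 𝔠.lane X 𝔖).Ineq41RestrictedAE (eps1Of S 𝔠.lane.carrier) k ∧
      (towerW 𝔠.lane X 𝔖).Ineq47RestrictedAE (eps1Of S 𝔠.lane.carrier) k := by
  haveI : RegularGaugeGroup G := groupModel_regularGaugeGroup 𝔊
  have D : ∀ j, j + 1 ≤ S.K → TrivStepInputs X 𝔠.lane.carrier 𝔖 (fun _ => True) j :=
    fun j hj => trivStepInputs_of_alpha_le hle j hj (R.steps j hj)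
  exact ⟨ineq41RestrictedAE_std X 𝔠.lane.carrier 𝔖 (fun _ => True) D k hk,
    ineq47RestrictedAE_std X 𝔠.lane.carrier 𝔖 (fun _ => True) D k hk⟩

/-- **THE χ-OF-(4) LOWER BOUND FROM (α) ON THE `≤`-FAMILY** (no `χ^{47}_k` factor): `χ_k·exp[F − E_k − Rm_k] ≤ ρ^res_k` dV-a.e., `k ≤ K`.
[cite: Balaban1985UV3, (47) p.267 + p.272 L32–33] -/
theorem restricted47_chi_of_alpha_le (R : RunAlpha 𝔊 𝔠 X 𝔖 𝔄) (k : ℕ) (hk : k ≤ S.K) :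
    ∀ᵐ V ∂(fieldMeasure S.P k G), (towerW 𝔠.lane X 𝔖).chi k V *
        Real.exp ((towerW 𝔠.lane X 𝔖).explicitExpo k V - (towerW 𝔠.lane X 𝔖).Ecst k - (towerW 𝔠.lane X 𝔖).Rm k)
      ≤ (towerW 𝔠.lane X 𝔖).rhoRes (eps1Of S 𝔠.lane.carrier) k V := by
  haveI : RegularGaugeGroup G := groupModel_regularGaugeGroup 𝔊
  exact restricted47_chi_ae X 𝔠.lane.carrier 𝔖 (fun _ => True)
    (fun j hj => trivStepInputs_of_alpha_le hle j hj (R.steps j hj)) k hk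

/-- **THE K1-S SANDWICH FROM (α) ON THE `≤`-FAMILY, NO THRESHOLD INCLUSION**: for dV-a.e. `g_kp(g_k)`-small `V`,
`e^{−E_k − Rm_k}·e^{F(V)} ≤ ρ^res_k(V) ≤ e^{−E_k + Rm_k}·e^{F(V)}`, `k ≤ K`. [cite: Balaban1985UV3, (41) p.266 + (47) p.267] -/
theorem sandwich_ae_of_alpha_le (R : RunAlpha 𝔊 𝔠 X 𝔖 𝔄) (k : ℕ) (hk : k ≤ S.K) :
    ∀ᵐ V ∂(fieldMeasure S.P k G), PlaqSmall (eps1Of S 𝔠.lane.carrier k) V →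
      Real.exp (-(towerW 𝔠.lane X 𝔖).Ecst k - (towerW 𝔠.lane X 𝔖).Rm k) * Real.exp ((towerW 𝔠.lane X 𝔖).explicitExpo k V)
        ≤ (towerW 𝔠.lane X 𝔖).rhoRes (eps1Of S 𝔠.lane.carrier) k V ∧
      (towerW 𝔠.lane X 𝔖).rhoRes (eps1Of S 𝔠.lane.carrier) k V
        ≤ Real.exp (-(towerW 𝔠.lane X 𝔖).Ecst k + (towerW 𝔠.lane X 𝔖).Rm k) * Real.exp ((towerW 𝔠.lane X 𝔖).explicitExpo k V) := by
  haveI : RegularGaugeGroup G := groupModel_regularGaugeGroup 𝔊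
  exact sandwich_ae_std X 𝔠.lane.carrier 𝔖 (fun _ => True)
    (fun j hj => trivStepInputs_of_alpha_le hle j hj (R.steps j hj)) k hk

/-- **THE UPPER READING FROM (α) ON THE `≤`-FAMILY AT ANY PROFILE `δ ≤ ε₁`** (e.g. `SectBThreshold.deltaMatched`): profile monotonicity
(`RestrictedResidualsAlpha.rhoRes_mono_ae`) + the reading at `ε₁`. [cite: Balaban1985UV3, (41) p.266] -/
theorem ineq41RestrictedAE_of_alpha_le_of_le (R : RunAlpha 𝔊 𝔠 X 𝔖 𝔄) (δ : ℕ → ℝ) (hδ : ∀ j, δ j ≤ eps1Of S 𝔠.lane.carrier j)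
    (k : ℕ) (hk : k ≤ S.K) : (towerW 𝔠.lane X 𝔖).Ineq41RestrictedAE δ k := by
  haveI : RegularGaugeGroup G := groupModel_regularGaugeGroup 𝔊
  refine ineq41RestrictedAE_of_le (towerW 𝔠.lane X 𝔖) k ?_ (restricted41_47_of_alpha_le hle R k hk).1
  exact rhoRes_mono_ae (towerW 𝔠.lane X 𝔖) hδ X.av_meas
    (integrable_rhoRes_std X 𝔠.lane.carrier 𝔖 (fun _ => True) δ)
    (integrable_rhoRes_std X 𝔠.lane.carrier 𝔖 (fun _ => True) (eps1Of S 𝔠.lane.carrier))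
    (integrable_T_rhoRes_std X 𝔠.lane.carrier 𝔖 (fun _ => True) δ)
    (integrable_T_rhoRes_std X 𝔠.lane.carrier 𝔖 (fun _ => True) (eps1Of S 𝔠.lane.carrier)) k

end AlphaLE

/-! ## Pinning the (41)/(47) slot changes nothing: the same for the PINNED tower `(laneT 𝔠 X 𝔖 G 𝔊 S).pin` (= `Inputs.towerOf`'s objects,
`TowerConstruction.tower` / `.toConstruction` of the END theorem) -/

section Pin

variable {S : Scales L} {G : Type} [GaugeGroup G] [MeasurableSpace G] [HaarData G] (W : SectB.TowerObjects S G)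

/-- The restricted densities do not read the (41)/(47) slot: `W.pin.rhoRes = W.rhoRes` (`pin` replaces only `ineq41_47`; `ρ₀`, `T` unchanged —
cf. the spine's `pin_rho`). [cite: Balaban1985UV3, (2) p.256 + (40) p.266] -/
theorem rhoRes_pin (δ : ℕ → ℝ) : ∀ k, W.pin.rhoRes δ k = W.rhoRes δ k
  | 0 => rfl
  | k + 1 => by
      funext V
      rw [SectB.TowerObjects.rhoRes_succ, SectB.TowerObjects.rhoRes_succ, rhoRes_pin δ k]
      rfl

/-- `Ineq41RestrictedAE` for the pinned objects is `Ineq41RestrictedAE` for the original ones. [cite: Balaban1985UV3, (41) p.266] -/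
theorem ineq41RestrictedAE_pin_iff (δ : ℕ → ℝ) (k : ℕ) : W.pin.Ineq41RestrictedAE δ k ↔ W.Ineq41RestrictedAE δ k := by
  unfold SectB.TowerObjects.Ineq41RestrictedAE
  rw [rhoRes_pin]
  exact Iff.rfl

/-- `Ineq47RestrictedAE` for the pinned objects is `Ineq47RestrictedAE` for the original ones. [cite: Balaban1985UV3, (47) p.267] -/
theorem ineq47RestrictedAE_pin_iff (δ : ℕ → ℝ) (k : ℕ) : W.pin.Ineq47RestrictedAE δ k ↔ W.Ineq47RestrictedAE δ k := by
  unfold SectB.TowerObjects.Ineq47RestrictedAE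
  rw [rhoRes_pin]
  exact Iff.rfl

end Pin

/-! ## In the quantifier shape of the END theorem -/

/-- **THE RESTRICTED (41)/(47) FOR `laneT 𝔠 X 𝔖`, IN THE QUANTIFIER SHAPE OF `uvStability3D_of_inputs`**: under the END theorem's own
hypothesis `hα` (the (α) inputs on the family of every group as printed), for every group `(G, 𝔊)`, every lattice approximation `S` of the
family and every `k ≤ K`, the tower objects `laneT 𝔠 X 𝔖 G 𝔊 S` satisfy the spine's restricted readings at `ε₁ = g_kp(g_k)`.  This is the
cell's P1-7 deliverable: the hypotheses `Ineq41Restricted`/`Ineq47Restricted` of node N6a (in their a.e. forms, the only shape an a.e.-defined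
`T` can inhabit) are THEOREMS MODULO (α) — the same trust base as node N4 (UV3). [cite: Balaban1985UV3, Thm 2 p.272 + (41) p.266 + (47) p.267] -/
theorem restricted41_47_of_inputs
    (𝔠 : ∀ (G : Type) [GaugeGroup G] [MeasurableSpace G] [HaarData G] (𝔊 : GroupModel G), AlphaConsts L 𝔊.N)
    (X : ∀ (G : Type) [GaugeGroup G] [MeasurableSpace G] [HaarData G], GroupModel G → ∀ S : Scales L, ExternalInputs S G)
    (𝔖 : ∀ (G : Type) [GaugeGroup G] [MeasurableSpace G] [HaarData G] (𝔊 : GroupModel G) (S : Scales L) (k : ℕ),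
      StepSeries S G ↥(GroupModelLieC.lieC 𝔊) (nblkOf S (𝔠 G 𝔊).lane.carrier k) k)
    (𝔄 : ∀ (G : Type) [GaugeGroup G] [MeasurableSpace G] [HaarData G] (𝔊 : GroupModel G) (S : Scales L),
      AlphaData 𝔊 (𝔠 G 𝔊) (X G 𝔊 S) (𝔖 G 𝔊 S))
    (hα : ∀ (G : Type) [GaugeGroup G] [MeasurableSpace G] [HaarData G] (𝔊 : GroupModel G) (S : Scales L),
      S.ε₀ = eps0Of (𝔠 G 𝔊).gamma0 S.g → RunAlpha 𝔊 (𝔠 G 𝔊) (X G 𝔊 S) (𝔖 G 𝔊 S) (𝔄 G 𝔊 S))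
    (G : Type) [GaugeGroup G] [MeasurableSpace G] [HaarData G] (𝔊 : GroupModel G) (S : Scales L)
    (hS : S.ε₀ = eps0Of (𝔠 G 𝔊).gamma0 S.g) (k : ℕ) (hk : k ≤ S.K) :
    (laneT 𝔠 X 𝔖 G 𝔊 S).Ineq41RestrictedAE (eps1Of S (𝔠 G 𝔊).lane.carrier) k ∧
      (laneT 𝔠 X 𝔖 G 𝔊 S).Ineq47RestrictedAE (eps1Of S (𝔠 G 𝔊).lane.carrier) k :=
  restricted41_47_of_alpha hS (hα G 𝔊 S hS) k hk

/-- The same for the PINNED tower objects `(laneT 𝔠 X 𝔖 G 𝔊 S).pin` — the `TowerObjects` whose run objects ARE the END theorem's construction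
`(laneT 𝔠 X 𝔖).toConstruction G 𝔊 S` (`EndTheorem.TowerConstruction.toConstruction`) and whose `TowerRun` is `Inputs.towerOf` — by
`ineq41RestrictedAE_pin_iff` / `ineq47RestrictedAE_pin_iff`. [cite: Balaban1985UV3, Thm 2 p.272 + (41) p.266 + (47) p.267] -/
theorem restricted41_47_of_inputs_pin
    (𝔠 : ∀ (G : Type) [GaugeGroup G] [MeasurableSpace G] [HaarData G] (𝔊 : GroupModel G), AlphaConsts L 𝔊.N)
    (X : ∀ (G : Type) [GaugeGroup G] [MeasurableSpace G] [HaarData G], GroupModel G → ∀ S : Scales L, ExternalInputs S G)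
    (𝔖 : ∀ (G : Type) [GaugeGroup G] [MeasurableSpace G] [HaarData G] (𝔊 : GroupModel G) (S : Scales L) (k : ℕ),
      StepSeries S G ↥(GroupModelLieC.lieC 𝔊) (nblkOf S (𝔠 G 𝔊).lane.carrier k) k)
    (𝔄 : ∀ (G : Type) [GaugeGroup G] [MeasurableSpace G] [HaarData G] (𝔊 : GroupModel G) (S : Scales L),
      AlphaData 𝔊 (𝔠 G 𝔊) (X G 𝔊 S) (𝔖 G 𝔊 S))
    (hα : ∀ (G : Type) [GaugeGroup G] [MeasurableSpace G] [HaarData G] (𝔊 : GroupModel G) (S : Scales L),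
      S.ε₀ = eps0Of (𝔠 G 𝔊).gamma0 S.g → RunAlpha 𝔊 (𝔠 G 𝔊) (X G 𝔊 S) (𝔖 G 𝔊 S) (𝔄 G 𝔊 S))
    (G : Type) [GaugeGroup G] [MeasurableSpace G] [HaarData G] (𝔊 : GroupModel G) (S : Scales L)
    (hS : S.ε₀ = eps0Of (𝔠 G 𝔊).gamma0 S.g) (k : ℕ) (hk : k ≤ S.K) :
    (laneT 𝔠 X 𝔖 G 𝔊 S).pin.Ineq41RestrictedAE (eps1Of S (𝔠 G 𝔊).lane.carrier) k ∧
      (laneT 𝔠 X 𝔖 G 𝔊 S).pin.Ineq47RestrictedAE (eps1Of S (𝔠 G 𝔊).lane.carrier) k := by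
  rw [ineq41RestrictedAE_pin_iff, ineq47RestrictedAE_pin_iff]
  exact restricted41_47_of_inputs 𝔠 X 𝔖 𝔄 hα G 𝔊 S hS k hk

/-! ## In the quantifier shape of `FamilyLE.uvStability3D_of_inputs_le` -/

/-- **THE RESTRICTED (41)/(47) FOR `laneT 𝔠 X 𝔖` ON THE `≤`-FAMILY, IN THE QUANTIFIER SHAPE OF `uvStability3D_of_inputs_le`**: for a group as
printed `(G, 𝔊)` whose (α) inputs hold for every `S` with `S.g²·S.ε₀ ≤ (min γ₀ 1)²`, every such `S` and every `k ≤ K`: the spine's restricted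
readings at `ε₁ = g_kp(g_k)` for the tower objects `laneT 𝔠 X 𝔖 G 𝔊 S`. [cite: Balaban1985UV3, Thm 2 p.272 + (41) p.266 + (47) p.267] -/
theorem restricted41_47_of_inputs_le
    (𝔠 : ∀ (G : Type) [GaugeGroup G] [MeasurableSpace G] [HaarData G] (𝔊 : GroupModel G), AlphaConsts L 𝔊.N)
    (X : ∀ (G : Type) [GaugeGroup G] [MeasurableSpace G] [HaarData G], GroupModel G → ∀ S : Scales L, ExternalInputs S G)
    (𝔖 : ∀ (G : Type) [GaugeGroup G] [MeasurableSpace G] [HaarData G] (𝔊 : GroupModel G) (S : Scales L) (k : ℕ),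
      StepSeries S G ↥(GroupModelLieC.lieC 𝔊) (nblkOf S (𝔠 G 𝔊).lane.carrier k) k)
    (𝔄 : ∀ (G : Type) [GaugeGroup G] [MeasurableSpace G] [HaarData G] (𝔊 : GroupModel G) (S : Scales L),
      AlphaData 𝔊 (𝔠 G 𝔊) (X G 𝔊 S) (𝔖 G 𝔊 S))
    (G : Type) [GaugeGroup G] [MeasurableSpace G] [HaarData G] (𝔊 : GroupModel G)
    (hα : ∀ S : Scales L, S.g ^ 2 * S.ε₀ ≤ (min (𝔠 G 𝔊).gamma0 1) ^ 2 → RunAlpha 𝔊 (𝔠 G 𝔊) (X G 𝔊 S) (𝔖 G 𝔊 S) (𝔄 G 𝔊 S))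
    (S : Scales L) (hle : S.g ^ 2 * S.ε₀ ≤ (min (𝔠 G 𝔊).gamma0 1) ^ 2) (k : ℕ) (hk : k ≤ S.K) :
    (laneT 𝔠 X 𝔖 G 𝔊 S).Ineq41RestrictedAE (eps1Of S (𝔠 G 𝔊).lane.carrier) k ∧
      (laneT 𝔠 X 𝔖 G 𝔊 S).Ineq47RestrictedAE (eps1Of S (𝔠 G 𝔊).lane.carrier) k :=
  restricted41_47_of_alpha_le hle (hα S hle) k hk

end Summit.QuantumFields.Balaban3D.Proofs.RestrictedResidualsAlpha

end
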